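/-
Origin: expansion seat `planner-pub-hodgecm-prl1-g2-0`, handover #5 2026-08-18T05:02:40Z (`HOME/pub-hodgecm-prl1-g2/lean/Prl1g2/ThetaCarrierFaithful.lean`, md5 da9a29df, 254 lines);
landed by the gen-6 packager in gate run 22 as `HodgeCM/Automorphic/ThetaCarrierFaithful.lean` (import ^import Prl1g2\.ThetaCarrier\b→import HodgeCM.Automorphic.ThetaCarrier ×1).
-/
/-
Origin: HOME/pub-hodgecm-prl1-g2/lean/Prl1g2/ThetaCarrierFaithful.lean — session planner-pub-hodgecm-prl1-g2-0
(unit pub-hodgecm-prl1-g2, EXPANSION PROVER a-1 gen 2).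
Intended final place (packager's call): `HodgeCM/Automorphic/ThetaCarrierFaithful.lean`; module rename
`Prl1g2.ThetaCarrier` ↦ `HodgeCM.Automorphic.ThetaCarrier` (mine, handed over before this file).  NEW, ADDITIVE.

KIND: KERNEL (L2 honesty certificate for `ThetaCarrier.lean`).  NOTHING is cited or posited here.

# The carrier refactor is FAITHFUL: it neither weakens nor strengthens the §3.3 axiom set

`ThetaCarrier.lean` replaces the three Prior records of `U.ThetaModel` (31 `Prop` fields per seesaw context) by prop-free
carriers plus the 19-field hypothesis `ThetaCarrier.Analytic`, and RECONSTRUCTS the Prior records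
(`toIsolationCore`, `toTorusData`, `ThetaModel.ofCarrier`) — so `Analytic` is AT LEAST as strong as the Prior records.
This file proves the converse: every Prior record ARISES from a carrier satisfying `Analytic`
(`CoreCarrier.ofCore`/`ofCore_analytic`, `TorusCarrier.ofTorusData`/`ofTorusData_analytic`,
`ThetaCarrier.ofModel`/`ofModel_analytic`), with the reconstructed operators EQUAL to the original ones
(`ofCore_R` (`rfl`), `ofCore_hatσC`, `ofCore_eσ`, `ofTorusData_Pw`, `ofTorusData_S12`).  Hence assuming
`(D : U.ThetaCarrier) (hA : D.Analytic)` is EXACTLY as strong as assuming `(T : U.ThetaModel)`: the refactor changes the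
visibility of the analytic axioms (left of the colon, by name), not their content.

The one analytic lemma doing the work (an elementary Hilbert-space fact, kernel-proved here):
`CoreCarrier.eq_starProjection_of_mem_of_fix_of_selfAdjoint` — a self-adjoint operator mapping into a complete subspace
`K` and fixing `K` pointwise IS the orthogonal projection onto `K` (uniqueness of `e_σ̂` and of `P_w`).
PROVED; closure = the standard trio.
-/
import Summits.HodgeConjecture.HodgeCM.Automorphic.ThetaCarrier_2

set_option autoImplicit false

noncomputable section

open scoped InnerProductSpace ComplexConjugate

namespace HodgeCM

open HodgeCM.Prior.Perl34File HodgeCM.Prior.Perl34File.Perl34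

namespace CoreCarrier

variable {H HG CG G SK SigIdx SigIdxG : Type}
variable [NormedAddCommGroup H] [InnerProductSpace ℂ H] [CompleteSpace H]
variable [NormedAddCommGroup HG] [InnerProductSpace ℂ HG] [CompleteSpace HG]
variable [NormedAddCommGroup CG] [NormedSpace ℂ CG]
variable [Group G] [TopologicalSpace G] [TopologicalSpace SK]

/-! ## 0. Two Hilbert-space lemmas -/

omit [CompleteSpace H] in
/-- **Uniqueness of the orthogonal projection**: a self-adjoint bounded operator `P` with `P v ∈ K` for all `v` and
`P v = v` on `K` equals `K.starProjection`. -/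
theorem eq_starProjection_of_mem_of_fix_of_selfAdjoint (K : Submodule ℂ H) [K.HasOrthogonalProjection]
    (P : H →L[ℂ] H) (hmem : ∀ v, P v ∈ K) (hfix : ∀ v ∈ K, P v = v)
    (hsa : ∀ u v : H, ⟪P u, v⟫_ℂ = ⟪u, P v⟫_ℂ) : P = K.starProjection := by
  ext v
  symm
  refine Submodule.eq_starProjection_of_mem_orthogonal (hmem v) ?_
  rw [Submodule.mem_orthogonal]
  intro u hu
  rw [inner_sub_right, ← hsa, hfix u hu, sub_self]

/-! ## 1. Every Prior `IsolationCore` arises from a core carrier -/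

variable (C : IsolationCore H HG CG G SK SigIdx SigIdxG)

/-- **The core carrier of a Prior `IsolationCore`** (forget the eleven `Prop` fields and `e_σ̂`). -/
def ofCore : CoreCarrier H HG CG G SK SigIdx SigIdxG where
  R := C.R
  omg := C.omg
  TΦc := C.TΦc
  inclCG := C.inclCG
  hatσ := C.hatσ
  hatτ := C.hatτ

/-- (Ported verbatim from the HodgeCMPerL package; no docstring in the source.) -/
@[simp] theorem ofCore_R : (ofCore C).R = C.R := rfl
/-- (Ported verbatim from the HodgeCMPerL package; no docstring in the source.) -/
@[simp] theorem ofCore_omg : (ofCore C).omg = C.omg := rfl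
/-- (Ported verbatim from the HodgeCMPerL package; no docstring in the source.) -/
@[simp] theorem ofCore_TΦc : (ofCore C).TΦc = C.TΦc := rfl
/-- (Ported verbatim from the HodgeCMPerL package; no docstring in the source.) -/
@[simp] theorem ofCore_inclCG : (ofCore C).inclCG = C.inclCG := rfl
/-- (Ported verbatim from the HodgeCMPerL package; no docstring in the source.) -/
@[simp] theorem ofCore_hatσ : (ofCore C).hatσ = C.hatσ := rfl
/-- (Ported verbatim from the HodgeCMPerL package; no docstring in the source.) -/
@[simp] theorem ofCore_hatτ : (ofCore C).hatτ = C.hatτ := rfl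
/-- (Ported verbatim from the HodgeCMPerL package; no docstring in the source.) -/
@[simp] theorem ofCore_TΦ (Φ : SK) : (ofCore C).TΦ Φ = C.TΦ Φ := rfl

/-- The closed components of the carrier ARE the (closed) Prior components. -/
@[simp] theorem ofCore_hatσC (i : SigIdx) : (ofCore C).hatσC i = C.hatσ i :=
  (C.hatσ_closed i).submodule_topologicalClosure_eq

/-- (Ported verbatim from the HodgeCMPerL package; no docstring in the source.) -/
@[simp] theorem ofCore_hatτC (j : SigIdxG) : (ofCore C).hatτC j = C.hatτ j :=
  (C.hatτ_closed j).submodule_topologicalClosure_eq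

/-- (Ported verbatim from the HodgeCMPerL package; no docstring in the source.) -/
theorem ofCore_invariant_iff (M : Submodule ℂ H) :
    (ofCore C).Invariant M ↔ ∀ (g : G), ∀ v ∈ M, C.R g v ∈ M := Iff.rfl

/-- **Uniqueness of `e_σ̂`**: the carrier's DEFINED projection equals the Prior record's `eσ` field. -/
theorem ofCore_eσ (i : SigIdx) : (ofCore C).eσ i = C.eσ i := by
  refine (eq_starProjection_of_mem_of_fix_of_selfAdjoint _ (C.eσ i) (fun v => ?_) (fun v hv => ?_)
    (C.eσ_selfAdjoint i)).symm
  · rw [ofCore_hatσC]; exact C.eσ_mem i v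
  · rw [ofCore_hatσC] at hv; exact C.eσ_fix i v hv

/-- **Every Prior `IsolationCore` satisfies the carrier's analytic axioms.** -/
theorem ofCore_analytic : (ofCore C).Analytic where
  R_unitary := C.R_unitary
  hatσ_invariant i g v hv := C.hatσ_invariant i g v hv
  hatσ_ortho i j hij u hu v hv := by
    rw [ofCore_hatσC] at hu hv
    exact C.hatσ_ortho i j hij u hu v hv
  hatσ_complete := C.hatσ_complete
  AX9_espectral M hM hinv i v hv := by
    rw [ofCore_eσ]
    exact C.AX9_espectral M hM hinv i v hv
  hatτ_complete := C.hatτ_complete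

end CoreCarrier

/-! ## 2. Every Prior `TorusData` arises from a torus carrier -/

namespace TorusCarrier

variable {H HG CG G SK SigIdx SigIdxG : Type}
variable [NormedAddCommGroup H] [InnerProductSpace ℂ H] [CompleteSpace H]
variable [NormedAddCommGroup HG] [InnerProductSpace ℂ HG] [CompleteSpace HG]
variable [NormedAddCommGroup CG] [NormedSpace ℂ CG]
variable [Group G] [TopologicalSpace G] [TopologicalSpace SK]
variable {C : IsolationCore H HG CG G SK SigIdx SigIdxG} (D : TorusData C)

/-- The fixed space of the Prior projection `P_w` (its `w`-eigenspace), as a submodule: `ker (1 - P_w)`. -/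
def fixedSpace : Submodule ℂ H := LinearMap.ker ((1 : H →L[ℂ] H) - D.Pw).toLinearMap

/-- (Ported verbatim from the HodgeCMPerL package; no docstring in the source.) -/
theorem mem_fixedSpace_iff (v : H) : v ∈ fixedSpace D ↔ D.Pw v = v := by
  change v - D.Pw v = 0 ↔ _
  rw [sub_eq_zero]
  exact eq_comm

/-- (Ported verbatim from the HodgeCMPerL package; no docstring in the source.) -/
theorem isClosed_fixedSpace : IsClosed (fixedSpace D : Set H) :=
  ContinuousLinearMap.isClosed_ker _

/-- **The torus carrier of a Prior `TorusData`** (forget the ten `Prop` fields, `S₁₂` and `P_w`; carry the fixed space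
of `P_w` as the `w`-eigenspace). -/
def ofTorusData : TorusCarrier (CoreCarrier.ofCore C) where
  X := D.X
  TestFn := D.TestFn
  allowed := D.allowed
  ϑc := D.ϑc
  E := D.E
  Ew := fixedSpace D
  wOccurs := D.wOccurs
  ETransl := D.ETransl

/-- (Ported verbatim from the HodgeCMPerL package; no docstring in the source.) -/
@[simp] theorem ofTorusData_EwC : (ofTorusData D).EwC = fixedSpace D :=
  (isClosed_fixedSpace D).submodule_topologicalClosure_eq

/-- **Uniqueness of `P_w`**: the carrier's DEFINED projection equals the Prior record's `Pw` field. -/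
@[simp] theorem ofTorusData_Pw : (ofTorusData D).Pw = D.Pw := by
  refine (CoreCarrier.eq_starProjection_of_mem_of_fix_of_selfAdjoint _ D.Pw (fun v => ?_) (fun v hv => ?_)
    D.Pw_selfAdjoint).symm
  · rw [ofTorusData_EwC, mem_fixedSpace_iff]
    exact congrArg (fun P : H →L[ℂ] H => P v) D.Pw_idem
  · rwa [ofTorusData_EwC, mem_fixedSpace_iff] at hv

/-- The carrier's DEFINED `S₁₂` equals the Prior record's `S12` field (by the Prior `S12_def`). -/
theorem ofTorusData_S12 : (ofTorusData D).S12 = D.S12 := D.S12_def.symm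

/-- **Every Prior `TorusData` satisfies the carrier's analytic axioms.** -/
theorem ofTorusData_analytic : (ofTorusData D).Analytic where
  AX5b_ϑ_cont := D.AX5b_ϑ_cont
  AX12_transl_cont := D.AX12_transl_cont
  AX12_E_transl := D.AX12_E_transl
  AX12_unfold_lift := D.AX12_unfold_lift
  AX12_molly := D.AX12_molly
  AX8_annihilation v hv := by
    rw [ofTorusData_Pw]
    exact D.AX8_annihilation v hv
  AX9_w_vector M hM hinv i hw hne := by
    rw [CoreCarrier.ofCore_hatσC] at hne ⊢
    simp only [ofTorusData_Pw]
    exact D.AX9_w_vector M hM hinv i hw hne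

end TorusCarrier

/-! ## 3. Every theta model arises from a theta carrier -/

namespace Universe.ThetaCarrier

variable {U : Universe}

/-- **The theta carrier of a theta model** (forget the 31 `Prop` fields per context). -/
def ofModel (T : U.ThetaModel) : U.ThetaCarrier where
  HG := T.HG
  emb := T.emb
  cover := T.cover
  kappa := T.kappa
  frameSign := T.frameSign
  H := T.H
  CG := T.CG
  G := T.G
  SK := T.SK
  SigIdx := T.SigIdx
  SigIdxG := T.SigIdxG
  core := fun V c => CoreCarrier.ofCore (T.core V c)
  t12 := fun V c => TorusCarrier.ofTorusData (T.t12 V c)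
  t34 := fun V c => TorusCarrier.ofTorusData (T.t34 V c)
  Theta := T.Theta

/-- **Every theta model satisfies the carrier's analytic hypotheses**: `ThetaCarrier.Analytic` is not stronger than
what `(T : U.ThetaModel)` already assumes. -/
theorem ofModel_analytic (T : U.ThetaModel) : (ofModel T).Analytic where
  core V c := CoreCarrier.ofCore_analytic (T.core V c)
  t12 V c := TorusCarrier.ofTorusData_analytic (T.t12 V c)
  t34 V c := TorusCarrier.ofTorusData_analytic (T.t34 V c)

/-- In particular the analytic hypotheses are satisfiable as soon as a theta model exists. -/
theorem analytic_nonempty_of_model (T : U.ThetaModel) : ∃ D : U.ThetaCarrier, D.Analytic :=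
  ⟨ofModel T, ofModel_analytic T⟩

/-- The round trip on the operators that the C-layer consumes: `R`, `σ̂`, `e_σ̂`, `S₁₂`, `P_w` of the model
reconstructed from `ofModel T` are those of `T`. -/
theorem ofCarrier_ofModel_core_R (T : U.ThetaModel) {L : CMField} {ι₁ : L →+* ℂ} (V : HermSpace3 L ι₁)
    (c : SeesawCtx L) :
    ((ThetaModel.ofCarrier (ofModel T) (ofModel_analytic T)).core V c).R = (T.core V c).R := rfl

/-- (Ported verbatim from the HodgeCMPerL package; no docstring in the source.) -/
theorem ofCarrier_ofModel_hatσ (T : U.ThetaModel) {L : CMField} {ι₁ : L →+* ℂ} (V : HermSpace3 L ι₁)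
    (c : SeesawCtx L) (i : T.SigIdx V c) :
    ((ThetaModel.ofCarrier (ofModel T) (ofModel_analytic T)).core V c).hatσ i = (T.core V c).hatσ i :=
  CoreCarrier.ofCore_hatσC _ i

/-- (Ported verbatim from the HodgeCMPerL package; no docstring in the source.) -/
theorem ofCarrier_ofModel_eσ (T : U.ThetaModel) {L : CMField} {ι₁ : L →+* ℂ} (V : HermSpace3 L ι₁)
    (c : SeesawCtx L) (i : T.SigIdx V c) :
    ((ThetaModel.ofCarrier (ofModel T) (ofModel_analytic T)).core V c).eσ i = (T.core V c).eσ i :=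
  CoreCarrier.ofCore_eσ _ i

/-- (Ported verbatim from the HodgeCMPerL package; no docstring in the source.) -/
theorem ofCarrier_ofModel_S12 (T : U.ThetaModel) {L : CMField} {ι₁ : L →+* ℂ} (V : HermSpace3 L ι₁)
    (c : SeesawCtx L) :
    ((ThetaModel.ofCarrier (ofModel T) (ofModel_analytic T)).t12 V c).S12 = (T.t12 V c).S12 :=
  TorusCarrier.ofTorusData_S12 _

/-- (Ported verbatim from the HodgeCMPerL package; no docstring in the source.) -/
theorem ofCarrier_ofModel_S34 (T : U.ThetaModel) {L : CMField} {ι₁ : L →+* ℂ} (V : HermSpace3 L ι₁)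
    (c : SeesawCtx L) :
    ((ThetaModel.ofCarrier (ofModel T) (ofModel_analytic T)).t34 V c).S12 = (T.t34 V c).S12 :=
  TorusCarrier.ofTorusData_S12 _

/-- (Ported verbatim from the HodgeCMPerL package; no docstring in the source.) -/
theorem ofCarrier_ofModel_Pw12 (T : U.ThetaModel) {L : CMField} {ι₁ : L →+* ℂ} (V : HermSpace3 L ι₁)
    (c : SeesawCtx L) :
    ((ThetaModel.ofCarrier (ofModel T) (ofModel_analytic T)).t12 V c).Pw = (T.t12 V c).Pw :=
  TorusCarrier.ofTorusData_Pw _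

/-- (Ported verbatim from the HodgeCMPerL package; no docstring in the source.) -/
theorem ofCarrier_ofModel_Pw34 (T : U.ThetaModel) {L : CMField} {ι₁ : L →+* ℂ} (V : HermSpace3 L ι₁)
    (c : SeesawCtx L) :
    ((ThetaModel.ofCarrier (ofModel T) (ofModel_analytic T)).t34 V c).Pw = (T.t34 V c).Pw :=
  TorusCarrier.ofTorusData_Pw _

end Universe.ThetaCarrier

end HodgeCM

end
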